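import Summits.KontsevichZagierPeriods.Zeta5Search.DualSeriesDenominators
import HarnessLib

/-!
# ζ(5) search — proved denominators of `F̃₇(b)` on the two rays the engines use (cell `pub-zeta5`, TYPER)

HONEST FRAMING: systematic search; no irrationality claim unless certified.

Instances of `DualSeriesDenominators.coeffU_den / coeffW_den / coeffV_den` (OUR theorem, Summit side) on

* the RECORD DUAL ray `b = n·(41; 17,16,15,14,13,12,11)` (`= n · bOfA(recordVec)`, Brown–Zudilin Sect. 9–10;
  the ray of gen-2's reconstruction runs): `N = (12n)!(13n)!(14n)!(15n)!(14n)!(13n)!`, `d = lcm(1..41n)`;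
* the SYMMETRIC ray `b = (3n; n,…,n)` (Zudilin 2002's `r_n`, Brown–Zudilin Sect. 2): `N = (n!)⁶`, `d = lcm(1..3n)`.

For each: the box / sum / pair conditions hold for every `n` (`omega`), the normaliser is the displayed product,
and `d·N·U, d³·N·W, d⁶·N·V ∈ ℤ`. 0 sorry.
-/

noncomputable section

open Finset
open Literature.NumberTheory.Transcendental

namespace Summit.KontsevichZagierPeriods.Zeta5Search

namespace DualSeriesDenominators

open DualSeries WedgeDictionary

/-- `((c·n : ℤ)).toNat = c·n`. -/
theorem toNat_natCast_mul (c n : ℕ) : ((c : ℤ) * (n : ℤ)).toNat = c * n := by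
  rw [show ((c : ℤ) * (n : ℤ)) = ((c * n : ℕ) : ℤ) by push_cast; ring, Int.toNat_natCast]

/-! ### The record dual ray -/

/-- `b = n·(41; 17,16,15,14,13,12,11)`. -/
def recRay (n : ℕ) : ℕ → ℤ
  | 0 => (41 : ℕ) * (n : ℤ) | 1 => (17 : ℕ) * (n : ℤ) | 2 => (16 : ℕ) * (n : ℤ) | 3 => (15 : ℕ) * (n : ℤ)
  | 4 => (14 : ℕ) * (n : ℤ) | 5 => (13 : ℕ) * (n : ℤ) | 6 => (12 : ℕ) * (n : ℤ) | 7 => (11 : ℕ) * (n : ℤ)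
  | _ => 0

/-- The natural parameters of the record dual ray. -/
theorem bn_recRay (n : ℕ) :
    bn (recRay n) 0 = 41 * n ∧ bn (recRay n) 1 = 17 * n ∧ bn (recRay n) 2 = 16 * n ∧ bn (recRay n) 3 = 15 * n
    ∧ bn (recRay n) 4 = 14 * n ∧ bn (recRay n) 5 = 13 * n ∧ bn (recRay n) 6 = 12 * n
    ∧ bn (recRay n) 7 = 11 * n := by
  simp only [bn, recRay, toNat_natCast_mul]
  trivial

/-- The record dual ray lies in the box. -/
theorem inBox_recRay (n : ℕ) : InBox (recRay n) := by
  refine ⟨by simp [recRay], fun j hj => ?_⟩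
  have hj' := mem_range.1 hj
  interval_cases j <;> simp [recRay] <;> omega

/-- `Σ_j b_j = 98n ≤ 3·41n + 1`. -/
theorem sum_recRay (n : ℕ) : ∑ j ∈ range 7, recRay n (j + 1) ≤ 3 * recRay n 0 + 1 := by
  simp [sum_range_succ, recRay]
  omega

/-- The six pair conditions on the record dual ray (`29n, 28n, 27n, 26n, 27n, 28n ≤ 41n`). -/
theorem pairs_recRay (n : ℕ) : ∀ s, s < 6 → bn (recRay n) (pfst s) + bn (recRay n) (psnd s) ≤ bn (recRay n) 0 := by
  obtain ⟨h0, h1, h2, h3, h4, h5, h6, h7⟩ := bn_recRay n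
  intro s hs
  interval_cases s <;> simp only [pfst, psnd] <;> omega

/-- **Record dual ray**: `N = (12n)!(13n)!(14n)!(15n)!(14n)!(13n)!`. -/
theorem normaliser_recRay (n : ℕ) :
    normaliser (recRay n) = (12 * n).factorial * (13 * n).factorial * (14 * n).factorial * (15 * n).factorial
      * (14 * n).factorial * (13 * n).factorial := by
  obtain ⟨h0, h1, h2, h3, h4, h5, h6, h7⟩ := bn_recRay n
  have e0 : blockLen (recRay n) 0 - 1 = 12 * n := by simp only [blockLen, pfst, psnd]; omega
  have e1 : blockLen (recRay n) 1 - 1 = 13 * n := by simp only [blockLen, pfst, psnd]; omega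
  have e2 : blockLen (recRay n) 2 - 1 = 14 * n := by simp only [blockLen, pfst, psnd]; omega
  have e3 : blockLen (recRay n) 3 - 1 = 15 * n := by simp only [blockLen, pfst, psnd]; omega
  have e4 : blockLen (recRay n) 4 - 1 = 14 * n := by simp only [blockLen, pfst, psnd]; omega
  have e5 : blockLen (recRay n) 5 - 1 = 13 * n := by simp only [blockLen, pfst, psnd]; omega
  rw [normaliser]
  simp only [prod_range_succ, prod_range_zero, one_mul]
  rw [e0, e1, e2, e3, e4, e5]

/-- **Record dual ray, `U`**: `lcm(1..41n) · N · U(n·(41;17,…,11)) ∈ ℤ`. -/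
theorem coeffU_den_recRay (n : ℕ) :
    ∃ z : ℤ, ((Nat.lcmUpto (41 * n) : ℕ) : ℚ) * (normaliser (recRay n) : ℚ) * coeffU (recRay n) = z := by
  have h := coeffU_den (inBox_recRay n) (pairs_recRay n) (sum_recRay n)
  rwa [(bn_recRay n).1] at h

/-- **Record dual ray, `W`**: `lcm(1..41n)³ · N · W ∈ ℤ`. -/
theorem coeffW_den_recRay (n : ℕ) :
    ∃ z : ℤ, ((Nat.lcmUpto (41 * n) : ℕ) : ℚ) ^ 3 * (normaliser (recRay n) : ℚ) * coeffW (recRay n) = z := by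
  have h := coeffW_den (inBox_recRay n) (pairs_recRay n) (sum_recRay n)
  rwa [(bn_recRay n).1] at h

/-- **Record dual ray, `V`**: `lcm(1..41n)⁶ · N · V ∈ ℤ`. -/
theorem coeffV_den_recRay (n : ℕ) :
    ∃ z : ℤ, ((Nat.lcmUpto (41 * n) : ℕ) : ℚ) ^ 6 * (normaliser (recRay n) : ℚ) * coeffV (recRay n) = z := by
  have h := coeffV_den (inBox_recRay n) (pairs_recRay n) (sum_recRay n)
  rwa [(bn_recRay n).1] at h

/-! ### The symmetric ray -/

/-- `b = (3n; n, n, n, n, n, n, n)`. -/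
def symRay (n : ℕ) : ℕ → ℤ
  | 0 => (3 : ℕ) * (n : ℤ) | 1 => (1 : ℕ) * (n : ℤ) | 2 => (1 : ℕ) * (n : ℤ) | 3 => (1 : ℕ) * (n : ℤ)
  | 4 => (1 : ℕ) * (n : ℤ) | 5 => (1 : ℕ) * (n : ℤ) | 6 => (1 : ℕ) * (n : ℤ) | 7 => (1 : ℕ) * (n : ℤ)
  | _ => 0

/-- The natural parameters of the symmetric ray. -/
theorem bn_symRay (n : ℕ) :
    bn (symRay n) 0 = 3 * n ∧ bn (symRay n) 1 = 1 * n ∧ bn (symRay n) 2 = 1 * n ∧ bn (symRay n) 3 = 1 * n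
    ∧ bn (symRay n) 4 = 1 * n ∧ bn (symRay n) 5 = 1 * n ∧ bn (symRay n) 6 = 1 * n
    ∧ bn (symRay n) 7 = 1 * n := by
  simp only [bn, symRay, toNat_natCast_mul]
  trivial

/-- The symmetric ray lies in the box. -/
theorem inBox_symRay (n : ℕ) : InBox (symRay n) := by
  refine ⟨by simp [symRay], fun j hj => ?_⟩
  have hj' := mem_range.1 hj
  interval_cases j <;> simp [symRay] <;> omega

/-- `Σ_j b_j = 7n ≤ 9n + 1`. -/
theorem sum_symRay (n : ℕ) : ∑ j ∈ range 7, symRay n (j + 1) ≤ 3 * symRay n 0 + 1 := by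
  simp [sum_range_succ, symRay]
  omega

/-- The six pair conditions on the symmetric ray (`2n ≤ 3n`). -/
theorem pairs_symRay (n : ℕ) : ∀ s, s < 6 → bn (symRay n) (pfst s) + bn (symRay n) (psnd s) ≤ bn (symRay n) 0 := by
  obtain ⟨h0, h1, h2, h3, h4, h5, h6, h7⟩ := bn_symRay n
  intro s hs
  interval_cases s <;> simp only [pfst, psnd] <;> omega

/-- **Symmetric ray**: `N = (n!)⁶` (Zudilin 2002's prefactor `n!⁴` in (7), up to `n!²`). -/
theorem normaliser_symRay (n : ℕ) : normaliser (symRay n) = n.factorial ^ 6 := by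
  obtain ⟨h0, h1, h2, h3, h4, h5, h6, h7⟩ := bn_symRay n
  have e : ∀ s, s < 6 → blockLen (symRay n) s - 1 = n := by
    intro s hs
    interval_cases s <;> simp only [blockLen, pfst, psnd] <;> omega
  rw [normaliser]
  simp only [prod_range_succ, prod_range_zero, one_mul]
  rw [e 0 (by norm_num), e 1 (by norm_num), e 2 (by norm_num), e 3 (by norm_num), e 4 (by norm_num),
    e 5 (by norm_num)]
  ring

/-- **Symmetric ray, `U`**: `lcm(1..3n) · (n!)⁶ · U(3n; n⁷) ∈ ℤ`. -/
theorem coeffU_den_symRay (n : ℕ) :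
    ∃ z : ℤ, ((Nat.lcmUpto (3 * n) : ℕ) : ℚ) * ((n.factorial : ℕ) : ℚ) ^ 6 * coeffU (symRay n) = z := by
  have h := coeffU_den (inBox_symRay n) (pairs_symRay n) (sum_symRay n)
  rw [(bn_symRay n).1, normaliser_symRay] at h
  push_cast at h
  exact h

/-- **Symmetric ray, `W`**: `lcm(1..3n)³ · (n!)⁶ · W ∈ ℤ`. -/
theorem coeffW_den_symRay (n : ℕ) :
    ∃ z : ℤ, ((Nat.lcmUpto (3 * n) : ℕ) : ℚ) ^ 3 * ((n.factorial : ℕ) : ℚ) ^ 6 * coeffW (symRay n) = z := by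
  have h := coeffW_den (inBox_symRay n) (pairs_symRay n) (sum_symRay n)
  rw [(bn_symRay n).1, normaliser_symRay] at h
  push_cast at h
  exact h

/-- **Symmetric ray, `V`**: `lcm(1..3n)⁶ · (n!)⁶ · V ∈ ℤ`. -/
theorem coeffV_den_symRay (n : ℕ) :
    ∃ z : ℤ, ((Nat.lcmUpto (3 * n) : ℕ) : ℚ) ^ 6 * ((n.factorial : ℕ) : ℚ) ^ 6 * coeffV (symRay n) = z := by
  have h := coeffV_den (inBox_symRay n) (pairs_symRay n) (sum_symRay n)
  rw [(bn_symRay n).1, normaliser_symRay] at h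
  push_cast at h
  exact h

end DualSeriesDenominators

end Summit.KontsevichZagierPeriods.Zeta5Search
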